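import Summits.ValiantsHypothesis.ValiantsHypothesis.Theorems.LacunarySymmetroidMatrixDescartesCensusBoundaryLiftTop
import Summits.ValiantsHypothesis.ValiantsHypothesis.Theorems.LacunarySymmetroidMatrixDescartesCensusDefs

/-!
# `MatrixDescartes` census — the lifting lemma in DOOR-A currency: support rows exclude boundary seventeens

HONEST FRAMING.  Object-search cell `pub-symmetroid`, crux `Theses.LacunarySymmetroid.MatrixDescartes`
(stmt-ValiantsHypothesis-18050); this file is a HELPER of that item with no closure claim.  It restates parts 2–3 of the
hierarchical lifting lemma (`twenty_of_boundary_seventeen`, `twenty_of_top_boundary_seventeen`) in the currency of the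
census rows `PosRootLawOn 2 6 19 d` (…CensusDefs) and of the cell's typed target `DoorA26 = PosRootLawAt 2 6 19` (OPEN,
never asserted): a boundary seventeen on `F₀(d)` or `F₅(d)` REFUTES the row of its support, and conversely every
kernel-certified row (the BOX20 replays, the uniform rays, …) EXCLUDES boundary seventeens on both strata of that support;
under `DoorA26` there are none anywhere.  Nothing here asserts `DoorA26`, bounds `ζ`, or bears on `MatrixDescartes` /
`VP ≠ VNP`.

[folklore] Bookkeeping; no citation exists or is needed.
-/

-- `Summit.ValiantsHypothesis.ValiantsHypothesis.…` repeats a component by the D-0017 layout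
-- (single-conjunct summit), which the `dupNamespace` linter flags; the name is mandated.
set_option linter.dupNamespace false

open Polynomial Finset
open scoped BigOperators Polynomial

namespace Summit.ValiantsHypothesis.ValiantsHypothesis.Theorems.LacunarySymmetroidMatrixDescartes.Census

open Summit.ValiantsHypothesis.ValiantsHypothesis.Theorems.MatrixDescartes.Negative (PosRootLawAt)

/-- **A boundary seventeen on `F₀(d)` refutes the row `ζ(2,6; d) ≤ 19`.** [folklore] -/
theorem not_posRootLawOn_of_boundary_seventeen (d : Fin 6 → ℕ) (hd : StrictMono d) (hd0 : d 0 = 0)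
    (h21 : d 2 < 2 * d 1) (S : Fin 6 → Matrix (Fin 2) (Fin 2) ℝ) (hS : ∀ l, (S l).IsSymm)
    (h00 : (S 0) 0 0 ≠ 0) (h01 : (S 0) 0 1 = 0) (h11 : ∀ l : Fin 6, l ≤ 2 → (S l) 1 1 = 0)
    (s : ℝ) (a : Fin 18 → ℝ) (hchain : AltChain (∑ l, (X : ℝ[X]) ^ d l • (S l).map C).det 17 s a) :
    ¬ PosRootLawOn 2 6 19 d := by
  intro hrow
  obtain ⟨S', hS', h20⟩ := twenty_of_boundary_seventeen d hd hd0 h21 S hS h00 h01 h11 s a hchain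
  have := hrow S' hS'
  omega

/-- **A boundary seventeen on the top stratum `F₅(d)` refutes the row `ζ(2,6; d) ≤ 19`.** [folklore] -/
theorem not_posRootLawOn_of_top_boundary_seventeen (d : Fin 6 → ℕ) (hd : StrictMono d)
    (h4 : 2 * d 4 < d 3 + d 5) (S : Fin 6 → Matrix (Fin 2) (Fin 2) ℝ) (hS : ∀ l, (S l).IsSymm)
    (h55 : (S 5) 0 0 ≠ 0) (h01 : (S 5) 0 1 = 0) (h11 : ∀ l : Fin 6, 3 ≤ l → (S l) 1 1 = 0)
    (s : ℝ) (a : Fin 18 → ℝ) (hchain : AltChain (∑ l, (X : ℝ[X]) ^ d l • (S l).map C).det 17 s a) :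
    ¬ PosRootLawOn 2 6 19 d := by
  intro hrow
  obtain ⟨S', hS', h20⟩ := twenty_of_top_boundary_seventeen d hd h4 S hS h55 h01 h11 s a hchain
  have := hrow S' hS'
  omega

/-- **Every certified support row excludes boundary seventeens on `F₀(d)`**: if `PosRootLawOn 2 6 19 d` (e.g. a BOX20 kernel
replay `doorA26_on_<d>` or a uniform ray theorem), then NO letters on the boundary stratum `F₀(d)` give a determinant with
an alternation chain of `18` positive points. [folklore] -/
theorem no_boundary_seventeen_of_posRootLawOn (d : Fin 6 → ℕ) (hd : StrictMono d) (hd0 : d 0 = 0)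
    (h21 : d 2 < 2 * d 1) (hrow : PosRootLawOn 2 6 19 d)
    (S : Fin 6 → Matrix (Fin 2) (Fin 2) ℝ) (hS : ∀ l, (S l).IsSymm)
    (h00 : (S 0) 0 0 ≠ 0) (h01 : (S 0) 0 1 = 0) (h11 : ∀ l : Fin 6, l ≤ 2 → (S l) 1 1 = 0)
    (s : ℝ) (a : Fin 18 → ℝ) : ¬ AltChain (∑ l, (X : ℝ[X]) ^ d l • (S l).map C).det 17 s a :=
  fun hchain => not_posRootLawOn_of_boundary_seventeen d hd hd0 h21 S hS h00 h01 h11 s a hchain hrow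

/-- The same on the top stratum `F₅(d)`. [folklore] -/
theorem no_top_boundary_seventeen_of_posRootLawOn (d : Fin 6 → ℕ) (hd : StrictMono d)
    (h4 : 2 * d 4 < d 3 + d 5) (hrow : PosRootLawOn 2 6 19 d)
    (S : Fin 6 → Matrix (Fin 2) (Fin 2) ℝ) (hS : ∀ l, (S l).IsSymm)
    (h55 : (S 5) 0 0 ≠ 0) (h01 : (S 5) 0 1 = 0) (h11 : ∀ l : Fin 6, 3 ≤ l → (S l) 1 1 = 0)
    (s : ℝ) (a : Fin 18 → ℝ) : ¬ AltChain (∑ l, (X : ℝ[X]) ^ d l • (S l).map C).det 17 s a :=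
  fun hchain => not_posRootLawOn_of_top_boundary_seventeen d hd h4 S hS h55 h01 h11 s a hchain hrow

/-- **Under `DoorA26` (OPEN, never asserted — taken here as a HYPOTHESIS) there is no boundary seventeen on any `F₀(d)` with
`d₂ < 2d₁`.** [folklore] -/
theorem no_boundary_seventeen_of_doorA26 (hA : DoorA26) (d : Fin 6 → ℕ) (hd : StrictMono d) (hd0 : d 0 = 0)
    (h21 : d 2 < 2 * d 1) (S : Fin 6 → Matrix (Fin 2) (Fin 2) ℝ) (hS : ∀ l, (S l).IsSymm)
    (h00 : (S 0) 0 0 ≠ 0) (h01 : (S 0) 0 1 = 0) (h11 : ∀ l : Fin 6, l ≤ 2 → (S l) 1 1 = 0)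
    (s : ℝ) (a : Fin 18 → ℝ) : ¬ AltChain (∑ l, (X : ℝ[X]) ^ d l • (S l).map C).det 17 s a :=
  no_boundary_seventeen_of_posRootLawOn d hd hd0 h21 (hA d) S hS h00 h01 h11 s a

end Summit.ValiantsHypothesis.ValiantsHypothesis.Theorems.LacunarySymmetroidMatrixDescartes.Census
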